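import Mathlib
import HarnessLib.Audit
import Summits.PneNP.PneNP.Theorems.PstarChordBridgeFundamental

/-!
# Forests of the XOR multigraph, path-free: strict vertex bound, fundamental sets of co-tree edges (ROUND-24, memo §9 R1 / §11 (N3))

FRONTIER range-avoidance ladder, rung F-N3, ROUND 24 (cell `pnp-ideate`, planner memo `r24/CORE-BOUND-NOTES.md` §2 ("take a spanning forest
`F ⊇ {centre edges}`; co-tree `N`; for `e ∈ N` with fundamental path `P_e ⊆ F` …"), §11 (N3); restricted-model proof complexity — nothing here bears on
`P` versus `NP`).

The bridge (`PstarChordBridge`) takes as DATA a fundamental set `D e ⊆ J₀ ∖ N` for every chord, with `D e + e` everywhere even.  This file shows,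
without paths, that such sets EXIST for the co-tree edges of a maximal forest, where "forest" is the peelable notion used by
`PstarChordBridgeLift.lift_of_peelable`:

* `Peelable I F` — every non-empty subset of `F` has a vertex of slot-degree exactly `1`;
* `card_lt_card_xverts` — a non-empty peelable set has fewer outputs than XOR vertices (forests: `#E < #V`);
* `card_xverts_le_of_leafless` — a set all of whose vertices have slot-degree `≥ 2` has at least as many outputs as vertices;
* `even_of_leafless_insert` — hence a leafless non-empty subset of `F + e` (`F` peelable) is 2-regular, in particular everywhere EVEN;
* `exists_fundamental` — **if `F` is peelable but `F + e` is not, then `e` has a fundamental set `D ⊆ F`** (`D + e` everywhere even); so the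
  co-tree edges of a MAXIMAL peelable subset of the core all have fundamental sets (`exists_fundamental_of_maximal`);
* `not_peelable_of_xorClosed` — a non-empty XOR-closed set of a typed instance is not peelable (every XOR vertex has slot-degree `≥ 2`), so a
  core always has co-tree edges (`N ≠ ∅`).
-/

set_option linter.dupNamespace false -- `Summit.PneNP.PneNP.…`: summit = sub-problem name (D-0017 single-conjunct layout)

open Finset Literature.Computability.Complexity
open Summit.PneNP.PneNP.Theorems.PstarTyped (Typed)
open Summit.PneNP.PneNP.Theorems.PstarSALevel (varSet bdry)
open Summit.PneNP.PneNP.Theorems.PstarCoreBound (XorClosed)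
open Summit.PneNP.PneNP.Theorems.PstarXorElimination (pdeg)
open Summit.PneNP.PneNP.Theorems.PstarXCore (xpair xverts mem_xpair card_xpair_le)
open Summit.PneNP.PneNP.Theorems.PstarCentreFree (vars_mem_varSet)
open Summit.PneNP.PneNP.Theorems.PstarChordBridgeTools
open Summit.PneNP.PneNP.Theorems.PstarChordBridgeFundamental (sum_xpdeg xpdeg_insert)

namespace Summit.PneNP.PneNP.Theorems.PstarChordBridgeCotree

variable {n m : ℕ}

/-- PEELABLE (a forest of the XOR multigraph, path-free): every non-empty subset has a vertex of slot-degree exactly `1`. -/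
def Peelable (I : LocalMap 4 n m) (F : Finset (Fin m)) : Prop := ∀ S ⊆ F, S.Nonempty → ∃ w, xpdeg I S w = 1

/-- Subsets of peelable sets are peelable. -/
theorem Peelable.subset {I : LocalMap 4 n m} {F S : Finset (Fin m)} (h : Peelable I F) (hS : S ⊆ F) : Peelable I S :=
  fun S' hS' hne => h S' (hS'.trans hS) hne

/-! ## Leaves -/

/-- A vertex is an XOR vertex of `S` iff its slot-degree in `S` is positive (pure instance). -/
theorem mem_xverts_iff_xpdeg_pos (I : LocalMap 4 n m) (S : Finset (Fin m)) (w : Fin n) : w ∈ xverts I S ↔ 0 < xpdeg I S w := by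
  unfold PstarXCore.xverts xpdeg pdeg
  dsimp only
  rw [mem_biUnion]
  constructor
  · rintro ⟨j, hj, hw⟩
    rcases (mem_xpair I).1 hw with rfl | rfl
    · have : j ∈ S.filter fun j' => I.vars j' 0 = I.vars j 0 := mem_filter.2 ⟨hj, rfl⟩
      have := card_pos.2 ⟨j, this⟩
      omega
    · have : j ∈ S.filter fun j' => I.vars j' 1 = I.vars j 1 := mem_filter.2 ⟨hj, rfl⟩
      have := card_pos.2 ⟨j, this⟩
      omega
  · intro h
    by_cases h0 : 0 < (S.filter fun j => I.vars j 0 = w).card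
    · obtain ⟨j, hj⟩ := card_pos.1 h0
      exact ⟨j, (mem_filter.1 hj).1, (mem_xpair I).2 (Or.inl (mem_filter.1 hj).2.symm)⟩
    · have h1 : 0 < (S.filter fun j => I.vars j 1 = w).card := by omega
      obtain ⟨j, hj⟩ := card_pos.1 h1
      exact ⟨j, (mem_filter.1 hj).1, (mem_xpair I).2 (Or.inr (mem_filter.1 hj).2.symm)⟩

/-- **A leaf edge**: a vertex of slot-degree `1` is touched by exactly one output of `S`. -/
theorem exists_leaf_edge (I : LocalMap 4 n m) {S : Finset (Fin m)} {w : Fin n} (hw : xpdeg I S w = 1) :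
    ∃ j ∈ S, w ∈ xpair I j ∧ ∀ j' ∈ S, w ∈ xpair I j' → j' = j := by
  have hw' : (S.filter fun j => I.vars j 0 = w).card + (S.filter fun j => I.vars j 1 = w).card = 1 := hw
  have key : ∀ j' ∈ S, w ∈ xpair I j' →
      j' ∈ (S.filter fun j => I.vars j 0 = w) ∪ (S.filter fun j => I.vars j 1 = w) := by
    intro j' hj' hwj'
    rw [mem_union, mem_filter, mem_filter]
    rcases (mem_xpair I).1 hwj' with h | h
    · exact Or.inl ⟨hj', h.symm⟩
    · exact Or.inr ⟨hj', h.symm⟩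
  have hU : ((S.filter fun j => I.vars j 0 = w) ∪ (S.filter fun j => I.vars j 1 = w)).card ≤ 1 :=
    (card_union_le _ _).trans hw'.le
  obtain ⟨j, hj, hwj⟩ := (mem_xverts_iff_xpdeg_pos I S w).2 (by rw [hw]; exact Nat.one_pos) |> fun h => by
    unfold PstarXCore.xverts at h; exact mem_biUnion.1 h
  refine ⟨j, hj, hwj, fun j' hj' hwj' => ?_⟩
  exact card_le_one.1 hU j' (key j' hj' hwj') j (key j hj hwj)

/-! ## Counting outputs against vertices -/

/-- **Forests have fewer edges than vertices**: a non-empty peelable set has `#S < #(xverts S)`. -/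
theorem card_lt_card_xverts (I : LocalMap 4 n m) (hI : I.IsPure xorAndPred) :
    ∀ S : Finset (Fin m), Peelable I S → S.Nonempty → S.card < (xverts I S).card := by
  classical
  intro S
  induction S using Finset.strongInduction with
  | H S ih =>
    intro hP hne
    obtain ⟨w, hw⟩ := hP S (Subset.refl S) hne
    obtain ⟨j, hj, hwj, huniq⟩ := exists_leaf_edge I hw
    -- `w` is not a vertex of `S - j`
    have hwS' : w ∉ xverts I (S.erase j) := by
      unfold PstarXCore.xverts
      rw [mem_biUnion]
      rintro ⟨j', hj', hw'⟩
      exact (mem_erase.1 hj').1 (huniq j' (mem_of_mem_erase hj') hw')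
    have hsub : xverts I (S.erase j) ⊆ (xverts I S).erase w := by
      intro v hv
      refine mem_erase.2 ⟨fun h => hwS' (h ▸ hv), ?_⟩
      unfold PstarXCore.xverts at hv ⊢
      rw [mem_biUnion] at hv ⊢
      obtain ⟨j', hj', hv⟩ := hv
      exact ⟨j', mem_of_mem_erase hj', hv⟩
    have hwS : w ∈ xverts I S := by
      unfold PstarXCore.xverts; rw [mem_biUnion]; exact ⟨j, hj, hwj⟩
    rcases (S.erase j).eq_empty_or_nonempty with h0 | hne'
    · -- `S = {j}`: two distinct XOR vertices
      have hS : S = {j} := by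
        ext j'
        constructor
        · intro hj'
          by_contra hne
          have : j' ∈ S.erase j := mem_erase.2 ⟨fun h => hne (mem_singleton.2 h), hj'⟩
          rw [h0] at this
          exact notMem_empty _ this
        · intro h
          rw [mem_singleton.1 h]; exact hj
      have h01 : I.vars j 0 ≠ I.vars j 1 := fun h => absurd (hI.2 j h) (by decide)
      have hx : xverts I S = xpair I j := by
        rw [hS]; unfold PstarXCore.xverts; exact singleton_biUnion
      rw [hx, hS, card_singleton]
      unfold PstarXCore.xpair
      rw [card_pair h01]
      exact Nat.lt_succ_self 1
    · have hlt := ih (S.erase j) (erase_ssubset hj) (hP.subset (erase_subset j S)) hne'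
      have h1 := card_le_card hsub
      rw [card_erase_of_mem hwS] at h1
      have h2 := card_erase_of_mem hj
      have h3 : 0 < (xverts I S).card := card_pos.2 ⟨w, hwS⟩
      omega

/-- **Leafless sets have at least as many outputs as vertices**: if every XOR vertex of `S` has slot-degree `≥ 2` then `#(xverts S) ≤ #S`. -/
theorem card_xverts_le_of_leafless (I : LocalMap 4 n m) {S : Finset (Fin m)} (hL : ∀ w ∈ xverts I S, 2 ≤ xpdeg I S w) :
    (xverts I S).card ≤ S.card := by
  classical
  have h1 : 2 * (xverts I S).card ≤ ∑ w ∈ xverts I S, xpdeg I S w := by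
    rw [mul_comm, card_eq_sum_ones, sum_mul]
    exact sum_le_sum fun w hw => by rw [one_mul]; exact hL w hw
  have h2 : ∑ w ∈ xverts I S, xpdeg I S w ≤ ∑ w, xpdeg I S w :=
    sum_le_sum_of_subset_of_nonneg (subset_univ _) fun _ _ _ => Nat.zero_le _
  rw [sum_xpdeg] at h2
  omega

/-- **A leafless non-empty subset of a forest plus one output is everywhere even** (it is a cycle: `#S = #(xverts S)` and all slot-degrees are `2`). -/
theorem even_of_leafless_insert (I : LocalMap 4 n m) (hI : I.IsPure xorAndPred) {F : Finset (Fin m)} (hP : Peelable I F) {e : Fin m}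
    {S : Finset (Fin m)} (hS : S ⊆ insert e F) (hne : S.Nonempty) (hL : ∀ w, xpdeg I S w ≠ 1) : ∀ w, Even (xpdeg I S w) := by
  classical
  -- `e ∈ S`, else `S ⊆ F` would have a leaf
  have heS : e ∈ S := by
    by_contra heS
    have hSF : S ⊆ F := fun j hj => (mem_insert.1 (hS hj)).resolve_left fun h => heS (h ▸ hj)
    obtain ⟨w, hw⟩ := hP S hSF hne
    exact hL w hw
  have hL2 : ∀ w ∈ xverts I S, 2 ≤ xpdeg I S w := fun w hw => by
    have h1 := (mem_xverts_iff_xpdeg_pos I S w).1 hw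
    have h2 := hL w
    omega
  have hle := card_xverts_le_of_leafless I hL2
  -- `S - e ⊆ F` is a non-empty forest: `#S - 1 < #(xverts (S - e)) ≤ #(xverts S)`
  have hS'F : S.erase e ⊆ F := fun j hj => (mem_insert.1 (hS (mem_of_mem_erase hj))).resolve_left (ne_of_mem_erase hj)
  have hne' : (S.erase e).Nonempty := by
    rw [← card_pos, card_erase_of_mem heS]
    by_contra h0
    have h1 : S.card = 1 := by have := card_pos.2 hne; omega
    obtain ⟨j, hj⟩ := card_eq_one.1 h1
    have hje : j = e := by have := heS; rw [hj, mem_singleton] at this; exact this.symm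
    -- a single output has a leaf
    apply hL (I.vars e 0)
    rw [hj, hje]
    unfold xpdeg pdeg
    have h01 : I.vars e 0 ≠ I.vars e 1 := fun h => absurd (hI.2 e h) (by decide)
    rw [filter_singleton, filter_singleton, if_pos rfl, if_neg (Ne.symm h01), card_singleton, card_empty]
  have hlt := card_lt_card_xverts I hI (S.erase e) (hP.subset hS'F) hne'
  have hmono : (xverts I (S.erase e)).card ≤ (xverts I S).card := by
    refine card_le_card fun v hv => ?_
    unfold PstarXCore.xverts at hv ⊢
    rw [mem_biUnion] at hv ⊢
    obtain ⟨j', hj', hv⟩ := hv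
    exact ⟨j', mem_of_mem_erase hj', hv⟩
  rw [card_erase_of_mem heS] at hlt
  have hcard : (xverts I S).card = S.card := by have := card_pos.2 hne; omega
  -- all slot-degrees on `xverts S` are exactly `2`
  have hsum : ∑ w ∈ xverts I S, xpdeg I S w = ∑ w ∈ xverts I S, 2 := by
    apply le_antisymm
    · have h2 : ∑ w ∈ xverts I S, xpdeg I S w ≤ ∑ w, xpdeg I S w :=
        sum_le_sum_of_subset_of_nonneg (subset_univ _) fun _ _ _ => Nat.zero_le _
      rw [sum_xpdeg] at h2
      rw [sum_const, smul_eq_mul, hcard]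
      omega
    · exact sum_le_sum fun w hw => hL2 w hw
  have heq := (sum_eq_sum_iff_of_le fun w hw => hL2 w hw).1 hsum.symm
  intro w
  by_cases hw : w ∈ xverts I S
  · rw [← heq w hw]; exact even_two
  · have : xpdeg I S w = 0 := by
      have := (mem_xverts_iff_xpdeg_pos I S w).not.1 hw
      omega
    rw [this]; exact Even.zero

/-- **Co-tree edges of a forest that cannot be extended have fundamental sets.**  If `F` is peelable and `F + e` is not, then there is `D ⊆ F`
with `e ∉ D` and `D + e` everywhere even. -/
theorem exists_fundamental (I : LocalMap 4 n m) (hI : I.IsPure xorAndPred) {F : Finset (Fin m)} (hP : Peelable I F) {e : Fin m}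
    (hmax : ¬ Peelable I (insert e F)) : ∃ D ⊆ F, e ∉ D ∧ ∀ w, Even (xpdeg I (insert e D) w) := by
  classical
  unfold Peelable at hmax
  push Not at hmax
  obtain ⟨S, hS, hne, hL⟩ := hmax
  have heven := even_of_leafless_insert I hI hP hS hne hL
  have heS : e ∈ S := by
    by_contra heS
    have hSF : S ⊆ F := fun j hj => (mem_insert.1 (hS hj)).resolve_left fun h => heS (h ▸ hj)
    obtain ⟨w, hw⟩ := hP S hSF hne
    exact hL w hw
  refine ⟨S.erase e, fun j hj => (mem_insert.1 (hS (mem_of_mem_erase hj))).resolve_left (ne_of_mem_erase hj),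
    fun h => (mem_erase.1 h).1 rfl, ?_⟩
  rw [insert_erase heS]
  exact heven

/-- **Maximal forests of the core**: if `F ⊆ J₀` is peelable and maximal among peelable subsets of `J₀`, every `e ∈ J₀ ∖ F` has a fundamental
set inside `F`. -/
theorem exists_fundamental_of_maximal (I : LocalMap 4 n m) (hI : I.IsPure xorAndPred) {J₀ F : Finset (Fin m)} (hF : F ⊆ J₀)
    (hP : Peelable I F) (hmax : ∀ F', F ⊆ F' → F' ⊆ J₀ → Peelable I F' → F' = F) {e : Fin m} (he : e ∈ J₀ \ F) :
    ∃ D ⊆ F, e ∉ D ∧ ∀ w, Even (xpdeg I (insert e D) w) := by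
  have heF : e ∉ F := (mem_sdiff.1 he).2
  refine exists_fundamental I hI hP fun hP' => heF ?_
  have := hmax (insert e F) (subset_insert e F) (insert_subset (mem_sdiff.1 he).1 hF) hP'
  rw [← this]
  exact mem_insert_self e F

/-- **A maximal peelable subset exists** inside any `J₀` (finiteness). -/
theorem exists_maximal_peelable (I : LocalMap 4 n m) (J₀ : Finset (Fin m)) :
    ∃ F ⊆ J₀, Peelable I F ∧ ∀ F', F ⊆ F' → F' ⊆ J₀ → Peelable I F' → F' = F := by
  classical
  -- peelable subsets of `J₀`, a non-empty family (it contains `∅`); take one of maximal cardinality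
  let P : Finset (Finset (Fin m)) := J₀.powerset.filter fun F => Peelable I F
  have hPne : P.Nonempty := ⟨∅, mem_filter.2 ⟨empty_mem_powerset J₀, fun S hS hne => by
    rw [subset_empty.1 hS] at hne; exact absurd hne (not_nonempty_empty)⟩⟩
  obtain ⟨F, hF, hmax⟩ := exists_max_image P Finset.card hPne
  rw [mem_filter, mem_powerset] at hF
  refine ⟨F, hF.1, hF.2, fun F' hFF' hF'J hP' => ?_⟩
  have hle := hmax F' (mem_filter.2 ⟨mem_powerset.2 hF'J, hP'⟩)
  exact (eq_of_subset_of_card_le hFF' hle).symm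

/-! ## Cores have co-tree edges -/

/-- **A non-empty XOR-closed set of a typed pure instance is not peelable**: a leaf vertex would be an XOR-slot variable read by exactly one output
of the set, i.e. a boundary XOR slot. -/
theorem not_peelable_of_xorClosed (I : LocalMap 4 n m) (hT : Typed I) {J₀ : Finset (Fin m)} (hX : XorClosed I J₀)
    (hne : J₀.Nonempty) : ¬ Peelable I J₀ := by
  classical
  intro hP
  obtain ⟨w, hw⟩ := hP J₀ (Subset.refl J₀) hne
  obtain ⟨j, hj, hwj, huniq⟩ := exists_leaf_edge I hw
  -- `w` is an XOR slot of `j`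
  obtain ⟨s, hs, hws⟩ : ∃ s : Fin 4, s.val < 2 ∧ I.vars j s = w := by
    rcases (mem_xpair I).1 hwj with h | h
    · exact ⟨0, by decide, h.symm⟩
    · exact ⟨1, by decide, h.symm⟩
  apply hX j hj s hs
  rw [hws]
  -- exactly one output of `J₀` reads `w`
  unfold PstarSALevel.bdry
  rw [mem_filter, card_eq_one]
  refine ⟨mem_univ w, j, ?_⟩
  ext j'
  rw [mem_filter, mem_singleton]
  constructor
  · rintro ⟨hj', hwv⟩
    unfold PstarSALevel.varSet at hwv
    obtain ⟨s', -, hs'⟩ := mem_image.1 hwv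
    by_cases hs'2 : s'.val < 2
    · refine huniq j' hj' ((mem_xpair I).2 ?_)
      have : s' = 0 ∨ s' = 1 := by
        rcases s' with ⟨s', h4⟩
        simp only [Fin.ext_iff] at *
        omega
      rcases this with rfl | rfl
      · exact Or.inl hs'.symm
      · exact Or.inr hs'.symm
    · exact absurd (hws.trans hs'.symm) (hT j j' s s' hs (by omega))
  · intro h
    rw [h]
    exact ⟨hj, hws ▸ vars_mem_varSet I j s⟩

/-- **A core has co-tree edges**: for a non-empty XOR-closed `J₀` and a peelable `F ⊆ J₀`, the complement `J₀ ∖ F` is non-empty. -/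
theorem sdiff_nonempty_of_xorClosed (I : LocalMap 4 n m) (hT : Typed I) {J₀ F : Finset (Fin m)} (hX : XorClosed I J₀)
    (hne : J₀.Nonempty) (hF : F ⊆ J₀) (hP : Peelable I F) : (J₀ \ F).Nonempty := by
  rw [nonempty_iff_ne_empty]
  intro h
  have hJF : J₀ = F := by
    refine Subset.antisymm (fun j hj => ?_) hF
    by_contra hjF
    have : j ∈ J₀ \ F := mem_sdiff.2 ⟨hj, hjF⟩
    rw [h] at this
    exact notMem_empty j this
  exact not_peelable_of_xorClosed I hT hX hne (hJF ▸ hP)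

end Summit.PneNP.PneNP.Theorems.PstarChordBridgeCotree
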